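import Mathlib
import Literature.MathematicalPhysics.QuantumFieldTheory.Luscher2010.TrivializingMaps
import Literature.Probability.Distributions.DistributionalTransform
import Summits.Ventures.LatticeQCDFlow.TrivializingMaps.TrivializingFlow
import HarnessLib

/-!
# THEOREM X — an exact trivializing map exists for every action, at every coupling and in every volume
# (transport form; measurable, not smooth)

HONEST FRAMING: exact (Metropolis-corrected) sampling algorithms for lattice gauge theory; figures of merit are
autocorrelation/cost numbers at stated couplings and volumes; no continuum-physics claim.

Venture `LatticeQCDFlow` (cell pub-lqcd), topic `TrivializingMaps`; FANOUT row 28 (theory-1), THEOREM X of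
THEORY-1 §32.  NEW WORK of the cell in the sense of ASSEMBLY only: the mathematics is the folklore measure
theory of standard Borel spaces (Kuratowski; the probability-integral / quantile transform, formalised in the
tree's `Literature/Probability/Distributions/{QuantileCoupling,DistributionalTransform}.lean` after
[Ruschendorf2013, §1.1]) applied to Lüscher's transport-form definition `IsTrivializingMap`
[Luscher2010Trivializing, §2.3 eq. (2.9)].  Nothing is cited as a fact; 0 `sorry`.

## What is proved

* §1 (pure measure theory) `map_cdf_eq_volume_Ioo` — for an atomless law `μ` on `ℝ` the distribution function
  pushes `μ` to Lebesgue measure on `(0,1)`; `exists_measurable_map_volume_Ioo_eq` — a MEASURABLE (everywhere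
  defined) version of the quantile transform pushes Lebesgue on `(0,1)` to any law `ν`;
  **`exists_measurable_map_eq_of_nullSingletonClass`** — on a standard Borel space every probability measure
  is the push-forward `T_* μ` of ANY atomless probability measure `μ` under some measurable self-map `T`
  (embed into `ℝ`, uniformise by the cdf, apply the quantile of the image law, pull back along a measurable
  left inverse of the embedding); `exists_measurable_map_eq_of_subsingleton` — the one-point case.
* §2 (the field manifold) `infinite_specialUnitaryGroup` (`SU(n)` is infinite for `n ≥ 2`: the circle
  `s ↦ diag((1+is)/(1-is), (1-is)/(1+is), 1, …, 1)` is injective), `nullSingletonClass_haarProbability` (the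
  normalised Haar measure of an infinite compact group has no atoms), `subsingleton_specialUnitaryGroup`
  (`SU(0)`, `SU(1)` are points), `standardBorelSpace_specialUnitaryGroup`.
* §3 **`exists_isTrivializingMap`** (THEOREM X) — for EVERY `d`, `L ≥ 1`, `n` and every action
  `S : GaugeConfig d L SU(n) → ℝ` whose Boltzmann weight is normalisable (`IsProbabilityMeasure (𝒵⁻¹e^{-S}D[U])`)
  there is a measurable `F` with `F_* D[V] = 𝒵⁻¹ e^{-S} D[U]`, i.e. `IsTrivializingMap S F`;
  **`exists_isTrivializingMap_of_continuous`** — in particular for every CONTINUOUS action (so for `β · S_W`,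
  Wilson's action, at EVERY real `β`, and for Lüscher's smooth ambient actions,
  `exists_isTrivializingMap_comp_coeConfig`).

READING.  In transport form, exact trivializing maps are never in short supply: existence holds at all couplings,
volumes and `n`, with no smallness condition — in contrast with the tree's CONSTRUCTIVE existence results, which
are either conditional on Lüscher's cited §3–§4 facts (`exists_isTrivializingMap_flow`) or confined to the
strong-coupling window `|β| < β₀` (`exists_isTrivializingMap_smul_ambWilsonAction`, continuous and
gauge-equivariant).  The map produced here is a Borel-isomorphism-type transport: wildly discontinuous, not
gauge-equivariant, of unbounded range — it carries no locality and no smoothness.  Read together with the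
cell's footprint theorems (PROP R / THEOREM C: no exact or dual-close map of finite range once the target has
connected correlations beyond that range; THEOREM Q: acceptance bounds footprint), THEOREM X pins down where the
content of "trivializing map" lies for samplers: not in existence or exactness, which are free, but in
REGULARITY and LOCALITY, which are what cost.  NOT CLAIMED: smoothness (Lüscher's theorem via Moser's method,
the cited `TrivializingMapExists`), continuity, gauge equivariance, invertibility (a Borel isomorphism mod null
sets exists too but is not proved here), any locality, any statement about flows, any number.
-/

namespace Summit.Ventures.LatticeQCDFlow.TrivializingMaps

open MeasureTheory Set Filter ProbabilityTheory
open Literature.MathematicalPhysics.QuantumFieldTheory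
open Literature.MathematicalPhysics.QuantumFieldTheory.Luscher2010
open scoped ENNReal Topology

/-! ## §1. Transport between probability measures on a standard Borel space -/

section Transport

/-- **Probability-integral transform, atomless case**: the distribution function `F_μ` pushes an atomless law
`μ` on `ℝ` to Lebesgue measure on `(0,1)` (from the tree's randomised version `map_distTransform_prod`, whose
randomisation is invisible off the atoms). [folklore; cite: Ruschendorf2013, Prop. 1.3] -/
theorem map_cdf_eq_volume_Ioo (μ : Measure ℝ) [IsProbabilityMeasure μ] [NullSingletonClass μ] :
    μ.map (cdf μ) = (volume : Measure ℝ).restrict (Ioo (0 : ℝ) 1) := by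
  have h := Literature.Probability.Distributions.map_distTransform_prod μ
  have hT : (fun p : ℝ × ℝ => Literature.Probability.Distributions.distTransform μ p.1 p.2) =
      cdf μ ∘ Prod.fst := by
    funext p
    exact Literature.Probability.Distributions.distTransform_eq_cdf_of_nullSingletonClass μ p.1 p.2
  rw [hT, ← Measure.map_map (monotone_cdf μ).measurable measurable_fst, Measure.map_fst_prod,
    Measure.restrict_apply_univ, Real.volume_Ioo, sub_zero, ENNReal.ofReal_one, one_smul] at h
  exact h

/-- **A measurable quantile transform**: for every law `ν` on `ℝ` there is an everywhere-defined MEASURABLE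
`Q : ℝ → ℝ` (the lower quantile `v ↦ inf {x | v ≤ F_ν x}` on `(0,1)`, `0` elsewhere) pushing Lebesgue measure
on `(0,1)` to `ν`.  Measurability: by the Galois property of the quantile, `{Q ≤ b}` is
`((0,1) ∩ (-∞, F_ν b]) ∪ ((0,1)ᶜ ∩ {0 ≤ b})`. [folklore; cite: Ruschendorf2013, Thm. 1.10 (d = 1)] -/
theorem exists_measurable_map_volume_Ioo_eq (ν : Measure ℝ) [IsProbabilityMeasure ν] :
    ∃ Q : ℝ → ℝ, Measurable Q ∧ ((volume : Measure ℝ).restrict (Ioo (0 : ℝ) 1)).map Q = ν := by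
  classical
  set q : ℝ → ℝ := fun v => sInf {x | v ≤ cdf ν x} with hq
  set Q : ℝ → ℝ := fun v => if v ∈ Ioo (0 : ℝ) 1 then q v else 0 with hQ
  have hQm : Measurable Q := by
    refine measurable_of_Iic fun b => ?_
    have hset : Q ⁻¹' Iic b =
        (Ioo (0 : ℝ) 1 ∩ Iic (cdf ν b)) ∪ ((Ioo (0 : ℝ) 1)ᶜ ∩ {_v | (0 : ℝ) ≤ b}) := by
      ext v
      simp only [mem_preimage, mem_Iic, mem_union, mem_inter_iff, mem_compl_iff, mem_setOf_eq]
      by_cases hv : v ∈ Ioo (0 : ℝ) 1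
      · have e : Q v = q v := if_pos hv
        rw [e]
        simp only [hv, true_and, not_true_eq_false, false_and, or_false]
        exact Literature.Probability.Distributions.sInf_setOf_le_cdf_le_iff ν hv.1 hv.2 b
      · have e : Q v = 0 := if_neg hv
        rw [e]
        simp only [hv, false_and, not_false_eq_true, true_and, false_or]
    rw [hset]
    refine (measurableSet_Ioo.inter measurableSet_Iic).union (measurableSet_Ioo.compl.inter ?_)
    by_cases hb : (0 : ℝ) ≤ b
    · simp only [hb, setOf_true]; exact MeasurableSet.univ
    · simp only [hb, setOf_false]; exact MeasurableSet.empty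
  refine ⟨Q, hQm, ?_⟩
  have hae : Q =ᵐ[(volume : Measure ℝ).restrict (Ioo (0 : ℝ) 1)] q := by
    filter_upwards [ae_restrict_mem measurableSet_Ioo] with v hv
    exact if_pos hv
  rw [Measure.map_congr hae]
  exact Literature.Probability.Distributions.map_sInf_cdf_volume_Ioo ν

/-- **Transport on a standard Borel space**: every probability measure `ν` is a measurable push-forward `T_* μ`
of ANY atomless probability measure `μ` (embed `X ↪ ℝ` measurably; the image of `μ` is atomless, its cdf pushes
it to Lebesgue on `(0,1)`; the measurable quantile of the image of `ν` pushes that to the image of `ν`; pull back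
along a measurable left inverse of the embedding). [folklore: Kuratowski / isomorphism theorem for standard
probability spaces, push-forward half] -/
theorem exists_measurable_map_eq_of_nullSingletonClass {X : Type*} [MeasurableSpace X]
    [StandardBorelSpace X] [Nonempty X] (μ ν : Measure X) [IsProbabilityMeasure μ]
    [IsProbabilityMeasure ν] [NullSingletonClass μ] :
    ∃ T : X → X, Measurable T ∧ μ.map T = ν := by
  obtain ⟨φ, hφ⟩ := MeasureTheory.exists_measurableEmbedding_real X
  haveI : IsProbabilityMeasure (μ.map φ) :=
    Measure.isProbabilityMeasure_map hφ.measurable.aemeasurable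
  haveI : IsProbabilityMeasure (ν.map φ) :=
    Measure.isProbabilityMeasure_map hφ.measurable.aemeasurable
  haveI : NullSingletonClass (μ.map φ) := ⟨fun t => by
    rw [Measure.map_apply hφ.measurable (measurableSet_singleton t)]
    exact (subsingleton_singleton.preimage hφ.injective).measure_zero μ⟩
  obtain ⟨Q, hQm, hQ⟩ := exists_measurable_map_volume_Ioo_eq (ν.map φ)
  obtain ⟨ψ, hψm, hψ⟩ := hφ.exists_measurable_extend measurable_id fun _ => ‹Nonempty X›
  have hu : Measurable (cdf (μ.map φ) ∘ φ) := (monotone_cdf _).measurable.comp hφ.measurable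
  refine ⟨ψ ∘ Q ∘ cdf (μ.map φ) ∘ φ, hψm.comp (hQm.comp hu), ?_⟩
  rw [← Measure.map_map hψm (hQm.comp hu), ← Measure.map_map hQm hu,
    ← Measure.map_map (monotone_cdf _).measurable hφ.measurable, map_cdf_eq_volume_Ioo, hQ,
    Measure.map_map hψm hφ.measurable, hψ, Measure.map_id]

/-- The one-point case: on a subsingleton space any two probability measures coincide, so `id` transports.
[folklore] -/
theorem exists_measurable_map_eq_of_subsingleton {X : Type*} [MeasurableSpace X] [Subsingleton X]
    (μ ν : Measure X) [IsProbabilityMeasure μ] [IsProbabilityMeasure ν] :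
    ∃ T : X → X, Measurable T ∧ μ.map T = ν := by
  refine ⟨id, measurable_id, ?_⟩
  rw [Measure.map_id]
  ext s _
  rcases s.eq_empty_or_nonempty with rfl | hne
  · rw [measure_empty, measure_empty]
  · rw [Subsingleton.eq_univ_of_nonempty hne, measure_univ, measure_univ]

end Transport

/-! ## §2. The field manifold: `SU(n)` is infinite (`n ≥ 2`), Haar is atomless, `SU(0)`, `SU(1)` are points -/

section Group

/-- **The normalised Haar measure of an infinite compact (T₁) group has no atoms**: all singletons have the
same Haar mass (`haar_singleton`), and infinitely many points of equal positive mass would have infinite total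
mass. [folklore] -/
theorem nullSingletonClass_haarProbability (G : Type*) [Group G] [TopologicalSpace G]
    [IsTopologicalGroup G] [CompactSpace G] [MeasurableSpace G] [BorelSpace G] [T1Space G] [Infinite G] :
    NullSingletonClass (haarProbability G) := by
  refine ⟨fun x => ?_⟩
  rw [haarProbability, Measure.haar_singleton]
  by_contra h
  have htop : Measure.haarMeasure (⊤ : TopologicalSpace.PositiveCompacts G) (univ : Set G) = ∞ :=
    Set.infinite_univ.meas_eq_top
      ⟨_, h, fun y _ => (Measure.haar_singleton (Measure.haarMeasure ⊤) y).ge⟩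
  have hfin : Measure.haarMeasure (⊤ : TopologicalSpace.PositiveCompacts G) (univ : Set G) < ∞ := by
    have := (inferInstance : IsProbabilityMeasure (haarProbability G))
    rw [haarProbability] at this
    exact measure_lt_top _ _
  exact hfin.ne htop

/-- The unit circle parametrised rationally: `z(s) = (1 + is)/(1 - is)` has `z(s) · conj z(s) = 1`. [folklore] -/
theorem cayley_mul_conj (s : ℝ) :
    (1 + (s : ℂ) * Complex.I) / (1 - (s : ℂ) * Complex.I) *
      (starRingEnd ℂ) ((1 + (s : ℂ) * Complex.I) / (1 - (s : ℂ) * Complex.I)) = 1 := by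
  have h1 : (1 : ℂ) - (s : ℂ) * Complex.I ≠ 0 := by
    intro h
    have := congrArg Complex.re h
    simp at this
  have h2 : (1 : ℂ) + (s : ℂ) * Complex.I ≠ 0 := by
    intro h
    have := congrArg Complex.re h
    simp at this
  have hconj : (starRingEnd ℂ) ((1 + (s : ℂ) * Complex.I) / (1 - (s : ℂ) * Complex.I)) =
      (1 - (s : ℂ) * Complex.I) / (1 + (s : ℂ) * Complex.I) := by
    rw [map_div₀]
    congr 1
    · simp [map_add, map_mul, Complex.conj_ofReal, Complex.conj_I]; ring
    · simp [map_sub, map_mul, Complex.conj_ofReal, Complex.conj_I]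
  rw [hconj, div_mul_div_comm, mul_comm (1 - (s : ℂ) * Complex.I), div_self (mul_ne_zero h2 h1)]

/-- The Cayley parametrisation `s ↦ (1 + is)/(1 - is)` of the circle is injective on `ℝ`. [folklore] -/
theorem cayley_injective : Function.Injective
    fun s : ℝ => (1 + (s : ℂ) * Complex.I) / (1 - (s : ℂ) * Complex.I) := by
  intro s t hst
  have hs : (1 : ℂ) - (s : ℂ) * Complex.I ≠ 0 := by
    intro h; have := congrArg Complex.re h; simp at this
  have ht : (1 : ℂ) - (t : ℂ) * Complex.I ≠ 0 := by
    intro h; have := congrArg Complex.re h; simp at this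
  have h := hst
  simp only at h
  rw [div_eq_div_iff hs ht] at h
  have him := congrArg Complex.im h
  simp at him
  linarith

/-- **`SU(n)` is infinite for `n ≥ 2`**: `s ↦ diag(z(s), conj z(s), 1, …, 1)` with `z(s) = (1+is)/(1-is)` is an
injection `ℝ ↪ SU(n)` (unitary: `|z| = 1`; determinant `z · conj z = 1`; injective in the `(0,0)` entry).
[folklore] -/
theorem infinite_specialUnitaryGroup {n : ℕ} (hn : 2 ≤ n) :
    Infinite (Matrix.specialUnitaryGroup (Fin n) ℂ) := by
  obtain ⟨m, rfl⟩ : ∃ m, n = m + 2 := ⟨n - 2, by omega⟩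
  -- the diagonal entries
  let z : ℝ → ℂ := fun s => (1 + (s : ℂ) * Complex.I) / (1 - (s : ℂ) * Complex.I)
  let v : ℝ → Fin (m + 2) → ℂ := fun s => Fin.cons (z s) (Fin.cons ((starRingEnd ℂ) (z s)) fun _ => 1)
  have hvv : ∀ s i, v s i * (starRingEnd ℂ) (v s i) = 1 := by
    intro s i
    refine Fin.cases ?_ (fun j => ?_) i
    · simp only [v, Fin.cons_zero]
      exact cayley_mul_conj s
    · refine Fin.cases ?_ (fun k => ?_) j
      · simp only [v, Fin.cons_succ, Fin.cons_zero, starRingEnd_self_apply]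
        rw [mul_comm]; exact cayley_mul_conj s
      · simp [v]
  have hmem : ∀ s, Matrix.diagonal (v s) ∈ Matrix.specialUnitaryGroup (Fin (m + 2)) ℂ := by
    intro s
    rw [Matrix.mem_specialUnitaryGroup_iff, Matrix.mem_unitaryGroup_iff, Matrix.det_diagonal]
    refine ⟨?_, ?_⟩
    · rw [Matrix.star_eq_conjTranspose, Matrix.diagonal_conjTranspose, Matrix.diagonal_mul_diagonal]
      have : (fun i => v s i * star (v s) i) = fun _ => (1 : ℂ) := funext fun i => hvv s i
      rw [this, Matrix.diagonal_one]
    · rw [Fin.prod_univ_succ, Fin.prod_univ_succ]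
      simp only [v, Fin.cons_zero, Fin.cons_succ, Finset.prod_const_one, mul_one]
      exact cayley_mul_conj s
  refine Infinite.of_injective (fun s : ℝ => (⟨Matrix.diagonal (v s), hmem s⟩ :
    Matrix.specialUnitaryGroup (Fin (m + 2)) ℂ)) fun s t hst => ?_
  have h := congrArg (fun A : Matrix.specialUnitaryGroup (Fin (m + 2)) ℂ =>
    (A : Matrix (Fin (m + 2)) (Fin (m + 2)) ℂ) 0 0) hst
  simp only [Matrix.diagonal_apply_eq, v, Fin.cons_zero] at h
  exact cayley_injective h

/-- `SU(0)` and `SU(1)` are one-point spaces. [folklore] -/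
theorem subsingleton_specialUnitaryGroup {n : ℕ} (hn : n ≤ 1) :
    Subsingleton (Matrix.specialUnitaryGroup (Fin n) ℂ) := by
  obtain rfl | rfl : n = 0 ∨ n = 1 := by omega
  · haveI : Subsingleton (Matrix (Fin 0) (Fin 0) ℂ) := inferInstanceAs (Subsingleton (Fin 0 → Fin 0 → ℂ))
    infer_instance
  · refine ⟨fun A B => Subtype.ext ?_⟩
    have hA := (Matrix.mem_specialUnitaryGroup_iff.mp A.2).2
    have hB := (Matrix.mem_specialUnitaryGroup_iff.mp B.2).2
    rw [Matrix.det_fin_one] at hA hB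
    ext i j
    have hi : i = 0 := Subsingleton.elim _ _
    have hj : j = 0 := Subsingleton.elim _ _
    subst hi; subst hj
    rw [hA, hB]

/-- `SU(n)` with its Borel σ-algebra (tree `Matrix.specialUnitaryGroup.instMeasurableSpace`) is a standard
Borel space: a compact, hence closed, subset of the Polish space of `n × n` complex matrices.  (Also recorded, as
an instance, in the tree's `Balaban1983to89/T4AveragingDisintegration.lean`; re-derived here to keep this file's
imports light.) [folklore] -/
theorem standardBorelSpace_specialUnitaryGroup (n : ℕ) :
    StandardBorelSpace (Matrix.specialUnitaryGroup (Fin n) ℂ) := by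
  haveI : PolishSpace (Matrix (Fin n) (Fin n) ℂ) := inferInstanceAs (PolishSpace (Fin n → Fin n → ℂ))
  haveI : PolishSpace (Matrix.specialUnitaryGroup (Fin n) ℂ) :=
    (isCompact_iff_compactSpace.mpr
      (inferInstanceAs (CompactSpace (Matrix.specialUnitaryGroup (Fin n) ℂ)))).isClosed.polishSpace
  infer_instance

end Group

/-! ## §3. THEOREM X: exact trivializing maps exist at every coupling, in every volume, for every `n` -/

section Gauge

variable {d L n : ℕ} [NeZero L]

/-- **THEOREM X (existence of exact trivializing maps in transport form, unconditionally).**  For every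
dimension `d`, every `L ≥ 1`, every `n` and every action `S` on `SU(n)`-valued lattice gauge fields whose
Boltzmann weight `𝒵⁻¹ e^{-S} D[U]` is a probability measure, there is a measurable field transformation `F` with
`F_* D[V] = 𝒵⁻¹ e^{-S} D[U]` — a trivializing map in the sense of [Luscher2010Trivializing, eq. (2.9)]
(`IsTrivializingMap S F`).  No smallness of any coupling, no smoothness of `S`.  Proof: for `n ≥ 2` and `d ≥ 1` the
trivial theory `D[V]` (a product of atomless Haar measures) is atomless on the standard Borel space `SU(n)^E`, so
§1 applies; otherwise the configuration space is a point. [cite: Luscher2010Trivializing, §1 and §2.3 eq. (2.9)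
(the definition transported; the smooth statement there is via Moser and is NOT this theorem)] -/
theorem exists_isTrivializingMap (S : GaugeConfig d L (Matrix.specialUnitaryGroup (Fin n) ℂ) → ℝ)
    [IsProbabilityMeasure (boltzmannMeasure S)] :
    ∃ F, IsTrivializingMap S F := by
  haveI : IsProbabilityMeasure (trivialMeasure (Matrix.specialUnitaryGroup (Fin n) ℂ) d L) := by
    unfold trivialMeasure; infer_instance
  by_cases h : Nonempty (Edge d L) ∧ 2 ≤ n
  · obtain ⟨hE, hn⟩ := h
    haveI := infinite_specialUnitaryGroup hn
    haveI : NullSingletonClass (haarProbability (Matrix.specialUnitaryGroup (Fin n) ℂ)) :=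
      nullSingletonClass_haarProbability _
    haveI : NullSingletonClass (trivialMeasure (Matrix.specialUnitaryGroup (Fin n) ℂ) d L) := by
      unfold trivialMeasure; infer_instance
    haveI := standardBorelSpace_specialUnitaryGroup n
    haveI : StandardBorelSpace (GaugeConfig d L (Matrix.specialUnitaryGroup (Fin n) ℂ)) := by
      unfold GaugeConfig; infer_instance
    exact exists_measurable_map_eq_of_nullSingletonClass _ _
  · haveI : Subsingleton (GaugeConfig d L (Matrix.specialUnitaryGroup (Fin n) ℂ)) := by
      rcases not_and_or.mp h with hE | hn
      · haveI : IsEmpty (Edge d L) := not_nonempty_iff.mp hE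
        unfold GaugeConfig; infer_instance
      · haveI := subsingleton_specialUnitaryGroup (n := n) (by omega)
        unfold GaugeConfig; infer_instance
    exact exists_measurable_map_eq_of_subsingleton _ _

/-- **THEOREM X for continuous actions — every coupling.**  Every continuous action on the compact field
manifold has `0 < 𝒵 < ∞` (`isProbabilityMeasure_boltzmannMeasure`), hence an exact measurable trivializing
map; in particular `β · S_W` (Wilson's action) at EVERY real `β`, in every volume, for every `n` — compare the
strong-coupling window of `exists_isTrivializingMap_smul_ambWilsonAction` and the conditional
`exists_isTrivializingMap_flow`. [cite: Luscher2010Trivializing, §1, §2.3 eq. (2.9)] -/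
theorem exists_isTrivializingMap_of_continuous
    {S : GaugeConfig d L (Matrix.specialUnitaryGroup (Fin n) ℂ) → ℝ} (hS : Continuous S) :
    ∃ F, IsTrivializingMap S F := by
  haveI := isProbabilityMeasure_boltzmannMeasure (d := d) (L := L) hS
  exact exists_isTrivializingMap S

/-- THEOREM X in Lüscher's setting of a smooth (here merely continuous) action of the ambient matrix variables
restricted to `SU(n)` (the shape of the cited `TrivializingMapExists`, minus smoothness of the map).
[cite: Luscher2010Trivializing, §1, §2.3 eq. (2.9)] -/
theorem exists_isTrivializingMap_comp_coeConfig {S : AmbConfig d L n → ℝ} (hS : Continuous S) :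
    ∃ F, IsTrivializingMap
      (fun U : GaugeConfig d L (Matrix.specialUnitaryGroup (Fin n) ℂ) => S (WilsonFlow.coeConfig U)) F :=
  exists_isTrivializingMap_of_continuous (hS.comp WilsonFlow.continuous_coeConfig)

end Gauge

end Summit.Ventures.LatticeQCDFlow.TrivializingMaps
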